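import Summits.ResolutionOfSingularities.ResolutionOfSingularities.Theorems.HilbertSamuelEliminationSigmaMaxModificationsCorridor3SigmaSurfaceBadnessPointCureCross
import HarnessLib

/-!
# [OURS · L1 W4.2] σ-LAYER PHASE B′ — `Corridor3SigmaSurfaceBadnessTrueSet`: the TRUE-SET clause of READY-TS — unreachable as typed, and its repair is implied by `M = 0`
# (crux chain w42 `SigmaMaxModifications` stmt-ResolutionOfSingularities-18506 / conjunct `SigmaMaxModificationsCorridor3` stmt-ResolutionOfSingularities-19249;
# res-L1-w42-stub-1 (gen 6) FINDING (TS-degenerate) 2026-08-27; `--supports stmt-…-19249 --as helper`, counted 0)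

HONEST FRAMING. OURS bookkeeping about res-type-067's readiness of record `ReadyTSOfRecord W E N ν D := E.ReadyOn ι_D ∧ (E.restrictOff ι_D).Nodup` (p542978, adopted by
res-L1-type-o1's `surfacePhaseReadyTS`, p544886) and this seat's badness count `badOfRecord` (p559520). NOTHING here is a statement of H. Hironaka's manuscript
[Hironaka2017] nor of [CossartJannsenSaito2020]; no named fact is used. AI-typed; AI review is weaker than expert review.

THE FINDING (kernel-checked below).
* `comap_eq_top_of_disjoint`: a boundary member whose support misses the image of `ι` pulls back to the UNIT ideal sheaf `⊤` — and `Boundary.restrictOff` KEEPS such members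
  (its filter only drops the members CONTAINING the image). `Boundary.restrictOff_pair_of_disjoint`: two such members give `[⊤, ⊤]`.
* `not_nodup_restrictOff_of_pair_disjoint`, **`not_readyTSOfRecord_of_pair_disjoint`**: as soon as `E` has members at two positions whose supports miss the (non-empty)
  surface `D`, `(E.restrictOff ι_D).Nodup` FAILS, hence `ReadyTSOfRecord W E N ν D` fails — whatever the traces ON `D` look like. Such `⊤`-traces have empty support, so
  they are invisible to `surfaceTraceSet` (`ℓ`) and to `badness` (`M`): a regular `D` with `ℓ = 0`, `M = 0` and two far-away boundary members is a state on which o1's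
  prep oracle of record is SILENT and which is NEVER READY-TS. (Run witness: two exceptional divisors of earlier point blow-ups at points off `D`.)
* THE REPAIR (TS′) «no repeated NON-EMPTY trace»: `((E.restrictOff ι_D).filter (· ≠ ⊤)).Nodup`. **`Boundary.nodup_filter_ne_top_of_badness_eq_zero`**: on a regular integral
  Noetherian scheme with locally principal non-zero members and finite crossing sets, `badness = 0` IMPLIES (TS′) — a repeated non-empty locally principal trace `Γ`
  has a codimension-one point `ζ` (`exists_divisorialPoint_specializes`), where `count Γ (membersThrough ζ) ≥ 2` contradicts `compMults ζ = [1]`.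
  **`nodup_filter_ne_top_restrictOff_of_badOfRecord_eq_zero`** (run shape) and **`readyOfRecord_and_nodupNE_of_badOfRecord_eq_zero`**: with (TS′) the converse (R-a)
  needs NO nodup hypothesis — «`D̃` regular ∧ `ℓ = 0` ∧ `M = 0` ⇒ `ReadyOfRecord` ∧ (TS′)».
  (rev 2) `…_of_stacks0BIC` / `…_of_mem_surfaceComponents`: the same with `hex` read through F-75c, in the binders of o1's oracle laws.

VACUITY SELF-CHECK. `not_readyTSOfRecord_of_pair_disjoint` has satisfiable hypotheses (`D` non-empty, `[I₁, I₂] <+ E`, supports disjoint from `D`) — it is a genuine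
obstruction, not an artefact of an empty binder; the (TS′) theorems are the positive replacement.
-/

noncomputable section

set_option linter.dupNamespace false -- mandated namespace of this single-conjunct summit

open CategoryTheory AlgebraicGeometry TopologicalSpace IsLocalRing
open Summit.ResolutionOfSingularities.ResolutionOfSingularities.Theorems.CampaignW42
open Literature.AlgebraicGeometry.Resolution Literature.RingTheory.HilbertSamuel

namespace Summit.ResolutionOfSingularities.ResolutionOfSingularities.Theorems.SigmaMaxModificationsCorridor3.Sigma

universe u

open Scheme.IdealSheafData

variable {W : Scheme.{u}}

/-! ## §1. Members missing `D` restrict to `⊤`, twice -/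

section Degenerate

variable {DS : Scheme.{u}}

/-- A member whose support misses the image of `ι` pulls back to the unit ideal sheaf. [folklore] -/
theorem comap_eq_top_of_disjoint (ι : DS ⟶ W) {I : W.IdealSheafData} (h : Disjoint (Set.range ι.base) (I.support : Set W)) : I.comap ι = ⊤ := by
  rw [← support_eq_bot_iff, support_comap]
  ext x
  simp only [Closeds.coe_preimage, Set.mem_preimage, Closeds.coe_bot, Set.mem_empty_iff_false, iff_false]
  exact fun hx => Set.disjoint_left.mp h ⟨x, rfl⟩ hx

/-- A member missing the (non-empty) image of `ι` passes the filter of `restrictOff`. [folklore] -/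
theorem not_range_subset_of_disjoint [Nonempty DS] (ι : DS ⟶ W) {I : W.IdealSheafData} (h : Disjoint (Set.range ι.base) (I.support : Set W)) :
    ¬ (Set.range ι.base ⊆ (I.support : Set W)) := by
  intro hsub
  obtain ⟨y⟩ := ‹Nonempty DS›
  exact Set.disjoint_left.mp h ⟨y, rfl⟩ (hsub ⟨y, rfl⟩)

/-- `restrictOff` is monotone for the sub-list order. [folklore] -/
theorem Boundary.restrictOff_sublist {E₁ E₂ : Boundary W} (h : E₁.Sublist E₂) (ι : DS ⟶ W) : (E₁.restrictOff ι).Sublist (E₂.restrictOff ι) := by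
  unfold Boundary.restrictOff
  exact (h.filter _).map _

/-- `restrictOff` of a cons whose head does not contain the image. [folklore] -/
theorem Boundary.restrictOff_cons_of_not_subset {E : Boundary W} (ι : DS ⟶ W) {I : W.IdealSheafData} (h : ¬ (Set.range ι.base ⊆ (I.support : Set W))) :
    Boundary.restrictOff (I :: E) ι = I.comap ι :: E.restrictOff ι := by
  classical
  unfold Boundary.restrictOff
  rw [List.filter_cons_of_pos (by simpa using h), List.map_cons]

/-- **TWO MEMBERS MISSING `D` RESTRICT TO `[⊤, ⊤]`.** [folklore] -/
theorem Boundary.restrictOff_pair_of_disjoint [Nonempty DS] (ι : DS ⟶ W) {I₁ I₂ : W.IdealSheafData}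
    (h₁ : Disjoint (Set.range ι.base) (I₁.support : Set W)) (h₂ : Disjoint (Set.range ι.base) (I₂.support : Set W)) :
    Boundary.restrictOff [I₁, I₂] ι = [⊤, ⊤] := by
  rw [Boundary.restrictOff_cons_of_not_subset ι (not_range_subset_of_disjoint ι h₁),
    Boundary.restrictOff_cons_of_not_subset ι (not_range_subset_of_disjoint ι h₂), Boundary.restrictOff_nil,
    comap_eq_top_of_disjoint ι h₁, comap_eq_top_of_disjoint ι h₂]

/-- **THE TRUE-SET CLAUSE FAILS WITH TWO MEMBERS MISSING `D`**: if `E` has members at two positions (`[I₁, I₂] <+ E`) whose supports miss the non-empty image of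
`ι`, then `E.restrictOff ι` repeats `⊤` and is not `Nodup`. [folklore] -/
theorem not_nodup_restrictOff_of_pair_disjoint [Nonempty DS] {E : Boundary W} (ι : DS ⟶ W) {I₁ I₂ : W.IdealSheafData} (h2 : List.Sublist [I₁, I₂] E)
    (h₁ : Disjoint (Set.range ι.base) (I₁.support : Set W)) (h₂ : Disjoint (Set.range ι.base) (I₂.support : Set W)) :
    ¬ (E.restrictOff ι).Nodup := by
  intro hnd
  have h := hnd.sublist (Boundary.restrictOff_sublist h2 ι)
  rw [Boundary.restrictOff_pair_of_disjoint ι h₁ h₂] at h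
  simp at h

end Degenerate

/-- **READY-TS (AS TYPED) IS UNREACHABLE ON A SURFACE MISSED BY TWO BOUNDARY MEMBERS**: for a non-empty closed `D ⊆ W` and a boundary `E` with members at two
positions whose supports are disjoint from `D`, `ReadyTSOfRecord W E N ν D` is false — independently of the traces on `D`. [folklore] -/
theorem not_readyTSOfRecord_of_pair_disjoint {E : Boundary W} {N : ℕ} {ν : ℕ → ℕ} {D : Closeds W} (hD : (D : Set W).Nonempty) {I₁ I₂ : W.IdealSheafData}
    (h2 : List.Sublist [I₁, I₂] E) (h₁ : Disjoint (D : Set W) (I₁.support : Set W)) (h₂ : Disjoint (D : Set W) (I₂.support : Set W)) :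
    ¬ ReadyTSOfRecord W E N ν D := by
  have hr : Set.range (menuCentre D).subschemeι.base = (D : Set W) := range_subschemeι_vanishingIdeal D
  haveI : Nonempty ↥(menuCentre D).subscheme := by
    obtain ⟨y, hy⟩ := hD
    rw [← hr] at hy
    obtain ⟨x, -⟩ := hy
    exact ⟨x⟩
  intro h
  exact not_nodup_restrictOff_of_pair_disjoint (menuCentre D).subschemeι h2 (hr ▸ h₁) (hr ▸ h₂) h.nodup

/-! ## §2. The repaired clause (TS′) «no repeated non-empty trace» follows from `M = 0` -/

section TruePrime

variable {D : Scheme.{u}} {Γs : Boundary D}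

/-- A member `≠ ⊤` has a point in its support. [folklore] -/
theorem support_nonempty_of_ne_top {Γ : D.IdealSheafData} (h : Γ ≠ ⊤) : ((Γ.support : Closeds D) : Set D).Nonempty := by
  rw [Set.nonempty_iff_ne_empty]
  intro he
  apply h
  rw [← support_eq_bot_iff]
  ext1
  simpa using he

open scoped Classical in
/-- **`M = 0` ⇒ NO REPEATED NON-EMPTY TRACE (TS′).** On a regular integral Noetherian scheme, for a configuration of non-zero locally principal members with finite
crossing sets, `badness = 0` forces the members different from `⊤` to be pairwise distinct as a list: a member `Γ ≠ ⊤` occurring twice has a codimension-one point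
`ζ` in its support (divisorial dictionary), through which `count Γ ≥ 2` members pass — against `compMults ζ = [1]` (`compMults_eq_singleton_of_badness_eq_zero`).
[folklore] -/
theorem Boundary.nodup_filter_ne_top_of_badness_eq_zero [IsIntegral D] [AlgebraicGeometry.IsNoetherian D] (hreg : Scheme.IsRegular D)
    (hlp : ∀ Γ ∈ Γs, IsLocallyPrincipal Γ) (hne : ∀ Γ ∈ Γs, Γ ≠ ⊥) (hfinX : ∀ Γ ∈ Γs, (Γs.crossingPts Γ).Finite) (hM : Γs.badness = 0) :
    (Γs.filter fun Γ => Γ ≠ ⊤).Nodup := by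
  rw [List.nodup_iff_count_le_one]
  intro Γ
  by_contra hlt
  have hpos : 0 < (Γs.filter fun Γ => Γ ≠ ⊤).count Γ := by omega
  obtain ⟨hΓ, hΓtop⟩ := List.mem_filter.mp (List.count_pos_iff.mp hpos)
  have hΓtop' : Γ ≠ ⊤ := by simpa using hΓtop
  have h2 : 2 ≤ Γs.count Γ := by
    rw [← List.count_filter (p := fun Γ : D.IdealSheafData => decide (Γ ≠ ⊤)) (a := Γ) (l := Γs) hΓtop]; omega
  obtain ⟨x, hx⟩ := support_nonempty_of_ne_top hΓtop'
  obtain ⟨ζ, hζ, -⟩ := exists_divisorialPoint_specializes hreg (hne Γ hΓ) (hlp Γ hΓ) hx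
  rw [mem_divisorialPoints_iff] at hζ
  have hζ1 : ζ ∈ Γs.codimOnePoints := ⟨Boundary.mem_divisorSet_iff.mpr ⟨Γ, hΓ, hζ.1⟩, hζ.2⟩
  have hnz : ∀ Γ ∈ Γs, ∀ y : D, stalkIdeal Γ y ≠ ⊥ := fun Γ hΓ y => stalkIdeal_ne_bot_of_ne_bot (hne Γ hΓ) y
  have h1 := Boundary.compMults_eq_singleton_of_badness_eq_zero (Boundary.codimOnePoints_finite hne) hfinX hnz hM hζ1
  have hlen : (membersThrough Γs ζ).length = 1 := by rw [← Boundary.length_compMults, h1, List.length_singleton]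
  have hcount : Γs.count Γ ≤ (membersThrough Γs ζ).length := by
    have h := List.count_filter (p := fun I : D.IdealSheafData => decide (ζ ∈ (I.support : Set D))) (a := Γ) (l := Γs) (by simpa using hζ.1)
    have h' : List.filter (fun I : D.IdealSheafData => decide (ζ ∈ (I.support : Set D))) Γs = membersThrough Γs ζ := by
      unfold membersThrough; rfl
    rw [← h, h']
    exact List.count_le_length
  omega

end TruePrime

/-! ## §3. Run shape: the converse (R-a) with (TS′) and NO nodup hypothesis -/

section Surface

variable {E : Boundary W} {N : ℕ} {ν : ℕ → ℕ} {D : Closeds W}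

open scoped Classical in
/-- **`M(E, D) = 0` ⇒ (TS′) FOR THE FILTERED TRACES OF RECORD** (irreducible `D`, `D̃` Noetherian regular of dimension `≤ 2`, boundary members locally principal).
[folklore] -/
theorem nodup_filter_ne_top_restrictOff_of_badOfRecord_eq_zero [AlgebraicGeometry.IsNoetherian (menuCentre D).subscheme]
    (hreg : Scheme.IsRegular (menuCentre D).subscheme) (hDirr : IsIrreducible (D : Set W)) (hdim : topologicalKrullDim ↥(menuCentre D).subscheme ≤ 2)
    (hE : ∀ B ∈ E, IsLocallyPrincipal B) (hM : badOfRecord W E D = 0) :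
    ((E.restrictOff (menuCentre D).subschemeι).filter fun Γ => Γ ≠ ⊤).Nodup := by
  haveI : IsIntegral (menuCentre D).subscheme := isIntegral_subscheme_vanishingIdeal D hDirr
  have hlp := isLocallyPrincipal_of_mem_restrictOff (ι := (menuCentre D).subschemeι) hE
  have hne := ne_bot_of_mem_restrictOff (E := E) (ι := (menuCentre D).subschemeι)
  have h2 := coheight_le_two_of_topologicalKrullDim_le hdim
  have hfinX : ∀ Γ ∈ E.restrictOff (menuCentre D).subschemeι, ((E.restrictOff (menuCentre D).subschemeι).crossingPts Γ).Finite :=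
    fun Γ hΓ => Boundary.crossingPts_finite_of_coheight_le_two h2 (hne Γ hΓ)
  rw [badOfRecord_eq] at hM
  exact Boundary.nodup_filter_ne_top_of_badness_eq_zero hreg hlp hne hfinX hM

open scoped Classical in
/-- **THE CONVERSE (R-a) IN (TS′) SHAPE, NODUP-FREE: `D̃` REGULAR ∧ `ℓ(E, D) = 0` ∧ `M(E, D) = 0` ⇒ `ReadyOfRecord` ∧ (TS′).** Same binders as
`readyTSOfRecord_of_badOfRecord_eq_zero` minus `hnodup`: the rev-1 readiness (regular ∧ filtered traces snc as a list) AND «no repeated non-empty trace». The third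
branch of o1's case rule is silent exactly on these states; with the readiness of record re-pointed to (TS′) they are READY. [folklore] -/
theorem readyOfRecord_and_nodupNE_of_badOfRecord_eq_zero [AlgebraicGeometry.IsNoetherian (menuCentre D).subscheme]
    (hreg : Scheme.IsRegular (menuCentre D).subscheme) (hDirr : IsIrreducible (D : Set W)) (hdim : topologicalKrullDim ↥(menuCentre D).subscheme ≤ 2)
    (hE : ∀ B ∈ E, IsLocallyPrincipal B) (hex : ∃ n, ExistsPointCompositionN (surfaceTraceSet E D) (ResolvesToSnc (surfaceTraceSet E D)) n)
    (hℓ : surfaceSncLength E D = 0) (hM : badOfRecord W E D = 0) :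
    ReadyOfRecord W E N ν D ∧ ((E.restrictOff (menuCentre D).subschemeι).filter fun Γ => Γ ≠ ⊤).Nodup := by
  refine ⟨?_, nodup_filter_ne_top_restrictOff_of_badOfRecord_eq_zero hreg hDirr hdim hE hM⟩
  haveI : IsIntegral (menuCentre D).subscheme := isIntegral_subscheme_vanishingIdeal D hDirr
  have hlp := isLocallyPrincipal_of_mem_restrictOff (ι := (menuCentre D).subschemeι) hE
  have hne := ne_bot_of_mem_restrictOff (E := E) (ι := (menuCentre D).subschemeι)
  have h2 := coheight_le_two_of_topologicalKrullDim_le hdim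
  have hfinX : ∀ Γ ∈ E.restrictOff (menuCentre D).subschemeι, ((E.restrictOff (menuCentre D).subschemeι).crossingPts Γ).Finite :=
    fun Γ hΓ => Boundary.crossingPts_finite_of_coheight_le_two h2 (hne Γ hΓ)
  have hM' : (E.restrictOff (menuCentre D).subschemeι).badness = 0 := by rwa [badOfRecord_eq] at hM
  have hS : IsStrictNormalCrossingsDivisor (menuCentre D).subscheme (surfaceTraceSet E D) := (surfaceSncLength_eq_zero_iff hex).mp hℓ
  exact ⟨hreg, Boundary.sncListOn_of_divisorSet_isSNC hreg
    (fun Γ hΓ x hx => Boundary.exists_prime_stalkIdeal_eq_span_of_badness_eq_zero hreg hlp hne hfinX hM' hΓ hx)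
    (fun Γ hΓ Γ' hΓ' hΓΓ' x hx hx' => Boundary.stalkIdeal_ne_of_badness_eq_zero hreg hlp hne hfinX hM' hΓ hΓ' hΓΓ' hx hx') hS⟩

open scoped Classical in
/-- **… AND WHEN NO MEMBER MISSES `D` THE TYPED CLAUSE ITSELF FOLLOWS**: if every filtered trace is `≠ ⊤` (no boundary member has support disjoint from `D`), then
`M = 0` gives `(E.restrictOff ι_D).Nodup` and hence `ReadyTSOfRecord` as typed. [folklore] -/
theorem readyTSOfRecord_of_badOfRecord_eq_zero_of_forall_ne_top [AlgebraicGeometry.IsNoetherian (menuCentre D).subscheme]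
    (hreg : Scheme.IsRegular (menuCentre D).subscheme) (hDirr : IsIrreducible (D : Set W)) (hdim : topologicalKrullDim ↥(menuCentre D).subscheme ≤ 2)
    (hE : ∀ B ∈ E, IsLocallyPrincipal B) (htop : ∀ Γ ∈ E.restrictOff (menuCentre D).subschemeι, Γ ≠ ⊤)
    (hex : ∃ n, ExistsPointCompositionN (surfaceTraceSet E D) (ResolvesToSnc (surfaceTraceSet E D)) n)
    (hℓ : surfaceSncLength E D = 0) (hM : badOfRecord W E D = 0) : ReadyTSOfRecord W E N ν D := by
  classical
  obtain ⟨hR, hnd⟩ := readyOfRecord_and_nodupNE_of_badOfRecord_eq_zero (N := N) (ν := ν) hreg hDirr hdim hE hex hℓ hM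
  have hfilter : ((E.restrictOff (menuCentre D).subschemeι).filter fun Γ => Γ ≠ ⊤) = E.restrictOff (menuCentre D).subschemeι :=
    List.filter_eq_self.mpr fun Γ hΓ => by simpa using htop Γ hΓ
  rw [hfilter] at hnd
  exact ⟨hR, hnd⟩

end Surface

section SurfaceF75

variable {E : Boundary W} {N : ℕ} {ν : ℕ → ℕ} {D : Closeds W}

open scoped Classical in
/-- **THE NODUP-FREE CONVERSE (R-a) WITH `hex` READ THROUGH F-75c** (`Stacks0BIC_embeddedResolutionCurvesInSurfaces_locus`: on a Noetherian regular excellent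
two-dimensional `D̃` the nowhere-dense closed `S(E, D)` has a resolving composition, `exists_existsPointCompositionN_of_isClosed_of_stacks0BIC_locus` +
`isNowhereDense_surfaceTraceSet`): `D` irreducible, `D̃` Noetherian regular excellent of dimension `2`, members locally principal, `ℓ = 0`, `M = 0` ⇒
`ReadyOfRecord` ∧ (TS′). [folklore] -/
theorem readyOfRecord_and_nodupNE_of_badOfRecord_eq_zero_of_stacks0BIC (hF : Stacks0BIC_embeddedResolutionCurvesInSurfaces_locus.{u})
    [AlgebraicGeometry.IsNoetherian (menuCentre D).subscheme] (hreg : Scheme.IsRegular (menuCentre D).subscheme) (hDirr : IsIrreducible (D : Set W))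
    (hexc : Scheme.IsExcellent (menuCentre D).subscheme) (hdim : topologicalKrullDim ↥(menuCentre D).subscheme = 2) (hE : ∀ B ∈ E, IsLocallyPrincipal B)
    (hℓ : surfaceSncLength E D = 0) (hM : badOfRecord W E D = 0) :
    ReadyOfRecord W E N ν D ∧ ((E.restrictOff (menuCentre D).subschemeι).filter fun Γ => Γ ≠ ⊤).Nodup :=
  readyOfRecord_and_nodupNE_of_badOfRecord_eq_zero hreg hDirr hdim.le hE
    (exists_existsPointCompositionN_of_isClosed_of_stacks0BIC_locus hF _ hreg hexc hdim (isClosed_surfaceTraceSet E D)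
      (isNowhereDense_surfaceTraceSet E hDirr)) hℓ hM

open scoped Classical in
/-- **… ON A SURFACE COMPONENT OF `X(ν)`** (binders of o1's oracle laws: `D ∈ surfaceComponents W N ν` supplies irreducibility and `dim D̃ = 2`). [folklore] -/
theorem readyOfRecord_and_nodupNE_of_badOfRecord_eq_zero_of_mem_surfaceComponents (hF : Stacks0BIC_embeddedResolutionCurvesInSurfaces_locus.{u})
    [AlgebraicGeometry.IsNoetherian (menuCentre D).subscheme] (hD : (D : Set W) ∈ surfaceComponents W N ν) (hreg : Scheme.IsRegular (menuCentre D).subscheme)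
    (hexc : Scheme.IsExcellent (menuCentre D).subscheme) (hE : ∀ B ∈ E, IsLocallyPrincipal B) (hℓ : surfaceSncLength E D = 0) (hM : badOfRecord W E D = 0) :
    ReadyOfRecord W E N ν D ∧ ((E.restrictOff (menuCentre D).subschemeι).filter fun Γ => Γ ≠ ⊤).Nodup := by
  have hdim : topologicalKrullDim ↥(menuCentre D).subscheme = 2 := by
    rw [topologicalKrullDim_subscheme_vanishingIdeal]; exact hD.2
  exact readyOfRecord_and_nodupNE_of_badOfRecord_eq_zero_of_stacks0BIC hF hreg (componentsIn.isIrreducible hD.1) hexc hdim hE hℓ hM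

end SurfaceF75

end Summit.ResolutionOfSingularities.ResolutionOfSingularities.Theorems.SigmaMaxModificationsCorridor3.Sigma

end
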